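import Mathlib
import HarnessLib
import Literature.MathematicalPhysics.QuantumLattice.KohnLuttinger
import Literature.MathematicalPhysics.QuantumLattice.KohnLuttingerChannelStates
import Summits.HubbardSuperconductivity.HubbardSuperconductivity.Theses.VestigialChirality
import Summits.HubbardSuperconductivity.HubbardSuperconductivity.Theorems.ChiralWindowCwKLChiralWindowD4Invariant
import Summits.HubbardSuperconductivity.HubbardSuperconductivity.Theorems.ChiralWindowCwKLChiralWindowGradient
import Summits.HubbardSuperconductivity.HubbardSuperconductivity.Theorems.CwKLChiralWindow.Negative.ChannelStructure

/-!
# `ChiralSelectionOddMoments` (route VestigialChirality, item stmt-HubbardSuperconductivity-2420)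

For gap functions `g₁ ∈ B₁g` and `g₂ ∈ B₂g` of the square-lattice point group `D₄` the mixed odd
Fermi-curve moments vanish,
`∫ g₁³ g₂ dμ_F = ∫ g₁ g₂³ dμ_F = 0`, `μ_F = fermiCurveMeasure (squareDispersion 1 0) μ`, for EVERY
`μ : ℝ` (Sigrist–Ueda-type selection rule: mixed odd-order Ginzburg–Landau invariants of a
two-component order parameter vanish by point-group symmetry).

Proof. Let `s = reflMomentum : (k₀, k₁) ↦ (k₀, -k₁)` (`= d4Momentum (sr 0)`).
* `om_b1g_refl`, `om_b2g_refl`: unfolding the isotypic projector `d4Project` at `k` and at `s k`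
  gives `g₁ ∘ s = g₁` and `g₂ ∘ s = -g₂`; hence both integrands are odd under `s`.
* `om_refl_measurePreserving`: `s` preserves `μ_F` for every `μ`: it is a surjective isometry, so it
  preserves arc length `μH[1]` (`kl_d4_measurePreserving_hausdorff`); the Fermi curve
  `F = {k ∈ [-π,π)² | ε₀ k = μ}` is `s`-invariant up to the at most four zone-boundary points
  `(±arccos (1 - μ/2), ±π)` (`om_symmDiff_subset`), a `μH[1]`-null set (no atoms), so
  `μH[1]⌊(s⁻¹F) = μH[1]⌊F`; and the density `‖∇ε₀‖⁻¹` is `s`-invariant (`stub_klGradient`,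
  `kl_d4_speed_refl`), so `kl_d4_measurePreserving_withDensity` applies.
* `om_integral_eq_zero_of_odd`: for a measure-preserving measurable involution and an odd
  integrand, `∫ F = ∫ F ∘ s = -∫ F` (change of variables along a measurable equivalence needs no
  integrability; the Bochner junk value `0` is covered automatically).
-/

noncomputable section

set_option linter.dupNamespace false

namespace Summit.HubbardSuperconductivity.HubbardSuperconductivity.Theorems

open MeasureTheory Literature.MathematicalPhysics.QuantumLattice
open scoped ENNReal

/-! ### Explicit coordinates -/

/-- A momentum is the pair of its coordinates. [folklore] -/
theorem om_eq_mk (k : Momentum) : k = WithLp.toLp 2 ![k 0, k 1] := by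
  ext i; fin_cases i <;> simp

/-! ### Parity of the one-dimensional channels under the axis reflection -/

/-- `B₁g` (`d_{x²-y²}`) gap functions are EVEN under the axis reflection `(k₀, k₁) ↦ (k₀, -k₁)`
(`char B₁g (sr 0) = +1`; pointwise, for every `InChannel .B1g` function). [folklore] -/
theorem om_b1g_refl {g : Momentum → ℝ} (h : InChannel .B1g g) (k : Momentum) :
    g (reflMomentum k) = g k := by
  have h1 := congrFun h (WithLp.toLp 2 ![k 0, k 1])
  have h2 := congrFun h (WithLp.toLp 2 ![k 0, -k 1])
  simp only [d4Project, sum_dihedralGroup_four, d4Momentum_r_zero, d4Momentum_r_one,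
    d4Momentum_r_two, d4Momentum_r_three, d4Momentum_sr_zero, d4Momentum_sr_one, d4Momentum_sr_two,
    d4Momentum_sr_three, D4Irrep.char, D4Irrep.dim, zmod_four_val.1, zmod_four_val.2.1,
    zmod_four_val.2.2.1, zmod_four_val.2.2.2, CwKLChiralWindow.Negative.rot_mk,
    CwKLChiralWindow.Negative.refl_mk, neg_neg] at h1 h2
  norm_num at h1 h2
  rw [om_eq_mk k, CwKLChiralWindow.Negative.refl_mk]
  linarith

/-- `B₂g` (`d_{xy}`) gap functions are ODD under the axis reflection `(k₀, k₁) ↦ (k₀, -k₁)`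
(`char B₂g (sr 0) = -1`). [folklore] -/
theorem om_b2g_refl {g : Momentum → ℝ} (h : InChannel .B2g g) (k : Momentum) :
    g (reflMomentum k) = -g k := by
  have h1 := congrFun h (WithLp.toLp 2 ![k 0, k 1])
  have h2 := congrFun h (WithLp.toLp 2 ![k 0, -k 1])
  simp only [d4Project, sum_dihedralGroup_four, d4Momentum_r_zero, d4Momentum_r_one,
    d4Momentum_r_two, d4Momentum_r_three, d4Momentum_sr_zero, d4Momentum_sr_one, d4Momentum_sr_two,
    d4Momentum_sr_three, D4Irrep.char, D4Irrep.dim, zmod_four_val.1, zmod_four_val.2.1,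
    zmod_four_val.2.2.1, zmod_four_val.2.2.2, CwKLChiralWindow.Negative.rot_mk,
    CwKLChiralWindow.Negative.refl_mk, neg_neg] at h1 h2
  norm_num at h1 h2
  rw [om_eq_mk k, CwKLChiralWindow.Negative.refl_mk]
  linarith

/-! ### The axis reflection preserves the Fermi-curve measure, for every `μ` -/

/-- The axis reflection is a measurable embedding (a measurable involution). [folklore] -/
theorem om_refl_measurableEmbedding : MeasurableEmbedding reflMomentum :=
  (⟨⟨reflMomentum, reflMomentum, kl_d4_refl_refl, kl_d4_refl_refl⟩,
    kl_d4_refl_isometry.continuous.measurable,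
    kl_d4_refl_isometry.continuous.measurable⟩ : Momentum ≃ᵐ Momentum).measurableEmbedding

/-- A level point of `ε₀` on the zone boundary `k₁ = ±π` with `k₀ ∈ [-π, π)` is one of the four
points `(±arccos (1 - μ/2), ±π)`. [folklore] -/
theorem om_mem_boundary_of {μ : ℝ} {k : Momentum} (hε : squareDispersion 1 0 k = μ)
    (h0 : k 0 ∈ Set.Ico (-Real.pi) Real.pi) (h1 : k 1 = Real.pi ∨ k 1 = -Real.pi) :
    k ∈ ({WithLp.toLp 2 ![Real.arccos (1 - μ / 2), Real.pi],
          WithLp.toLp 2 ![-Real.arccos (1 - μ / 2), Real.pi],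
          WithLp.toLp 2 ![Real.arccos (1 - μ / 2), -Real.pi],
          WithLp.toLp 2 ![-Real.arccos (1 - μ / 2), -Real.pi]} : Set Momentum) := by
  have hcos1 : Real.cos (k 1) = -1 := by
    rcases h1 with h1 | h1
    · rw [h1, Real.cos_pi]
    · rw [h1, Real.cos_neg, Real.cos_pi]
  have hcos0 : Real.cos (k 0) = 1 - μ / 2 := by
    rw [kl_d4_eps_apply, hcos1] at hε
    linarith
  have habs : |k 0| ≤ Real.pi := abs_le.2 ⟨h0.1, h0.2.le⟩
  have ha : Real.arccos (1 - μ / 2) = |k 0| := by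
    rw [← hcos0, ← Real.cos_abs, Real.arccos_cos (abs_nonneg _) habs]
  have hk0 : k 0 = Real.arccos (1 - μ / 2) ∨ k 0 = -Real.arccos (1 - μ / 2) := by
    rw [ha]
    rcases le_or_gt 0 (k 0) with h | h
    · exact Or.inl (abs_of_nonneg h).symm
    · exact Or.inr (by rw [abs_of_neg h, neg_neg])
  have hk := om_eq_mk k
  simp only [Set.mem_insert_iff, Set.mem_singleton_iff]
  rcases hk0 with ha0 | ha0 <;> rcases h1 with hb | hb <;> rw [ha0, hb] at hk
  · exact Or.inl hk
  · exact Or.inr (Or.inr (Or.inl hk))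
  · exact Or.inr (Or.inl hk)
  · exact Or.inr (Or.inr (Or.inr hk))

/-- The Fermi curve `F = {k ∈ [-π,π)² | ε₀ k = μ}` and its reflected preimage differ only inside
the four zone-boundary points `(±arccos (1 - μ/2), ±π)`. [folklore] -/
theorem om_symmDiff_subset (μ : ℝ) :
    (reflMomentum ⁻¹' fermiCurve (squareDispersion 1 0) μ) \ fermiCurve (squareDispersion 1 0) μ ∪
      fermiCurve (squareDispersion 1 0) μ \ (reflMomentum ⁻¹' fermiCurve (squareDispersion 1 0) μ) ⊆
    ({WithLp.toLp 2 ![Real.arccos (1 - μ / 2), Real.pi],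
      WithLp.toLp 2 ![-Real.arccos (1 - μ / 2), Real.pi],
      WithLp.toLp 2 ![Real.arccos (1 - μ / 2), -Real.pi],
      WithLp.toLp 2 ![-Real.arccos (1 - μ / 2), -Real.pi]} : Set Momentum) := by
  rintro k (⟨hr, hn⟩ | ⟨hm, hn⟩)
  · -- `refl k ∈ F`, `k ∉ F`: then `k₀ ∈ [-π,π)`, `-k₁ ∈ [-π,π)` but `k₁ ∉ [-π,π)`, so `k₁ = π`.
    rw [Set.mem_preimage, mem_fermiCurve_iff, kl_d4_eps_refl] at hr
    rw [mem_fermiCurve_iff] at hn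
    have hBZ := hr.1
    simp only [brillouinZone, Set.mem_setOf_eq, Fin.forall_fin_two, kl_d4_refl_apply_zero,
      kl_d4_refl_apply_one, Set.mem_Ico] at hBZ
    have hk1 : ¬ (k 1 ∈ Set.Ico (-Real.pi) Real.pi) := by
      intro hk1
      apply hn
      refine ⟨?_, hr.2⟩
      simp only [brillouinZone, Set.mem_setOf_eq, Fin.forall_fin_two, Set.mem_Ico]
      exact ⟨hBZ.1, hk1.1, hk1.2⟩
    rw [Set.mem_Ico, not_and_or, not_le, not_lt] at hk1
    have h1 : k 1 = Real.pi := by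
      rcases hk1 with h | h
      · linarith [hBZ.2.2]
      · linarith [hBZ.2.1]
    exact om_mem_boundary_of hr.2 ⟨hBZ.1.1, hBZ.1.2⟩ (Or.inl h1)
  · -- `k ∈ F`, `refl k ∉ F`: then `k₁ ∈ [-π,π)` but `-k₁ ∉ [-π,π)`, so `k₁ = -π`.
    rw [mem_fermiCurve_iff] at hm
    rw [Set.mem_preimage, mem_fermiCurve_iff, kl_d4_eps_refl] at hn
    have hBZ := hm.1
    simp only [brillouinZone, Set.mem_setOf_eq, Fin.forall_fin_two, Set.mem_Ico] at hBZ
    have hk1 : ¬ (-k 1 ∈ Set.Ico (-Real.pi) Real.pi) := by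
      intro hk1
      apply hn
      refine ⟨?_, hm.2⟩
      simp only [brillouinZone, Set.mem_setOf_eq, Fin.forall_fin_two, kl_d4_refl_apply_zero,
        kl_d4_refl_apply_one, Set.mem_Ico]
      exact ⟨hBZ.1, hk1.1, hk1.2⟩
    rw [Set.mem_Ico, not_and_or, not_le, not_lt] at hk1
    have h1 : k 1 = -Real.pi := by
      rcases hk1 with h | h
      · linarith [hBZ.2.2]
      · linarith [hBZ.2.1]
    exact om_mem_boundary_of hm.2 hBZ.1 (Or.inr h1)

/-- The reflected preimage of the Fermi curve agrees with the Fermi curve `μH[1]`-almost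
everywhere (arc length has no atoms). [folklore] -/
theorem om_preimage_ae_eq (μ : ℝ) :
    (reflMomentum ⁻¹' fermiCurve (squareDispersion 1 0) μ : Set Momentum) =ᵐ[(μH[1] : Measure Momentum)]
      fermiCurve (squareDispersion 1 0) μ := by
  haveI := Measure.nullSingletonClass_hausdorff Momentum (d := 1) one_pos
  have hZ : (μH[1] : Measure Momentum)
      ({WithLp.toLp 2 ![Real.arccos (1 - μ / 2), Real.pi],
        WithLp.toLp 2 ![-Real.arccos (1 - μ / 2), Real.pi],
        WithLp.toLp 2 ![Real.arccos (1 - μ / 2), -Real.pi],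
        WithLp.toLp 2 ![-Real.arccos (1 - μ / 2), -Real.pi]} : Set Momentum) = 0 :=
    Set.Finite.measure_zero (Set.toFinite _) _
  have hsub := om_symmDiff_subset μ
  rw [Set.union_subset_iff] at hsub
  exact ae_eq_set.2 ⟨measure_mono_null hsub.1 hZ, measure_mono_null hsub.2 hZ⟩

/-- **The axis reflection preserves the Fermi-curve measure of `ε₀`, for every `μ`.**
[folklore] -/
theorem om_refl_measurePreserving (μ : ℝ) :
    MeasurePreserving reflMomentum (fermiCurveMeasure (squareDispersion 1 0) μ)
      (fermiCurveMeasure (squareDispersion 1 0) μ) := by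
  have hFm : MeasurableSet (fermiCurve (squareDispersion 1 0) μ) :=
    measurableSet_fermiCurve (measurable_squareDispersion 1 0) μ
  have h1 := (kl_d4_measurePreserving_hausdorff kl_d4_refl_isometry
    kl_d4_refl_surjective).restrict_preimage hFm
  rw [Measure.restrict_congr_set (om_preimage_ae_eq μ)] at h1
  unfold fermiCurveMeasure
  exact kl_d4_measurePreserving_withDensity h1 (kl_d4_measurable_density _)
    (fun k => by rw [kl_d4_speed_refl stub_klGradient k])

/-! ### Odd integrands integrate to zero -/

/-- For a measure preserved by the axis reflection, every reflection-odd integrand has vanishing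
Bochner integral (no integrability needed: `∫ F = ∫ F ∘ s = -∫ F`). [folklore] -/
theorem om_integral_eq_zero_of_odd {σ : Measure Momentum}
    (hσ : MeasurePreserving reflMomentum σ σ) {F : Momentum → ℝ}
    (hF : ∀ k, F (reflMomentum k) = -F k) : ∫ k, F k ∂σ = 0 := by
  have h1 : ∫ k, F (reflMomentum k) ∂σ = ∫ k, F k ∂σ :=
    hσ.integral_comp om_refl_measurableEmbedding F
  have h2 : ∫ k, F (reflMomentum k) ∂σ = -∫ k, F k ∂σ := by
    simp_rw [hF]
    exact integral_neg F
  linarith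

/-! ### The item -/

/-- **`ChiralSelectionOddMoments`** (item stmt-HubbardSuperconductivity-2420): for `g₁ ∈ B₁g`,
`g₂ ∈ B₂g` and every `μ`, `∫ g₁³ g₂ dμ_F = 0` and `∫ g₁ g₂³ dμ_F = 0` on the Fermi curve of the
nearest-neighbour band — both integrands are odd under the axis reflection, which preserves `μ_F`.
[folklore] -/
theorem chiralSelectionOddMoments_proof :
    Summit.HubbardSuperconductivity.HubbardSuperconductivity.Theses.VestigialChirality.ChiralSelectionOddMoments := by
  unfold Summit.HubbardSuperconductivity.HubbardSuperconductivity.Theses.VestigialChirality.ChiralSelectionOddMoments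
  intro μ g₁ g₂ h1 h2
  have hσ := om_refl_measurePreserving μ
  refine ⟨om_integral_eq_zero_of_odd hσ (fun k => ?_), om_integral_eq_zero_of_odd hσ (fun k => ?_)⟩
  · rw [om_b1g_refl h1, om_b2g_refl h2]; ring
  · rw [om_b1g_refl h1, om_b2g_refl h2]; ring

end Summit.HubbardSuperconductivity.HubbardSuperconductivity.Theorems

end
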